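import Summits.CriticalPhenomena.PercolationContinuityZ3.Theorems.PercNearOneGluingNoHeavyQuantTLCShiftedTarget
import Summits.CriticalPhenomena.PercolationContinuityZ3.Theorems.PercNearOneGluingNoHeavyQuantTLCNaturalLayer
import HarnessLib

/-!
# QUANT lane R8, the node G₁ for a GENERAL partner, part 2b: `LawDec.TLC` FROM ONE ROW PER THRESHOLD — the depth-≤1 family of a
# nonnegative law is generated by its natural-layer rows

builds on p205010 (kernel theorem, internal audit signed; external expert review pending)

Support file (`--supports stmt-CriticalPhenomena-4575`), QUANT lane seat prim-quant-arm-2 (gen 40); memo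
`run/shared/lean/prim/quant/prim-quant-arm-2-g40/G1-GENERAL-G40.md` §2.  One theorem, standard axioms, no sorries; corollary of part 2
(`…QuantTLCNaturalLayer`: `tlcRow_functional_of_naturalLayer`, `tlcCoef_le_of_layer_le_expensive`) with part 1's bridge `tlc_functional_sum`.

**`tlc_of_naturalRows`.**  `0 < y < 1`, `ν ≥ 0` on `{0..M}`, target `τ`.  For each threshold `t` let `js t ≥ t` be a NATURAL LAYER: every compatible
mid `a ≤ js t` of `t` is expensive (`y·(a − t) ≤ τ − 2t`) and every atom `js t < a ≤ M` is a cheap compatible mid (`τ < t + a`, `τ − 2t ≤ y·(a − t)`) —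
e.g. `js t = ⌊t + (τ − 2t)/y⌋`.  If for every threshold `t < M` with `2t < τ` the single top-low-capacity row `(min (js t) (M−1), t)` holds, then the
whole family `LawDec.TLC y τ M ν` holds (all layers `j < M`, all thresholds): below the natural layer a row is weaker because raising the layer across
expensive-or-incompatible atoms raises the coefficients, above it because lowering the layer across cheap mids does.  So the depth-≤1 polytope of
census-2 g64 is cut out by at most `⌈τ/2⌉` capacity rows (plus sign constraints), independently of `M`.
HONEST STATUS: G₁ (`TLC2GateConvTLC`), SGC and `Quant.FarTreeRow` (light) remain OPEN; nothing here is cited as a published result; the lane's RATE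
class log\* and honest sentence (`run/shared/lean/prim/quant/README.md`) are unchanged.

[this work]; `TLC`: prim-quant-census-2 g64; `usage`/`pairGate`: prim-quant-stmt g22 (this lane).  The gluing rows served
[cite: KozmaNitzan2024, Conjecture 3 (p. 15)]; product measure [cite: Grimmett1999, §1.3 p. 10].
-/

noncomputable section

namespace Summit.CriticalPhenomena.PercolationContinuityZ3.Theorems

namespace Quant

open Finset

namespace LawDec

/-- **`TLC` FROM ONE ROW PER THRESHOLD** (see the module docstring). [this work] -/
theorem tlc_of_naturalRows (y τ : ℝ) (M : ℕ) (ν : ℕ → ℝ) (js : ℕ → ℕ) (hy0 : 0 < y) (hy1 : y < 1) (hν : ∀ a, 0 ≤ ν a)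
    (hjs : ∀ t, t ≤ js t)
    (hexp : ∀ t a : ℕ, t < a → a ≤ js t → τ < (t : ℝ) + a → y * ((a : ℝ) - t) ≤ τ - 2 * (t : ℝ))
    (hcheap : ∀ t a : ℕ, js t < a → a ≤ M → τ < (t : ℝ) + a ∧ τ - 2 * (t : ℝ) ≤ y * ((a : ℝ) - t))
    (hrows : ∀ t : ℕ, 2 * (t : ℝ) < τ → t < M →
      y / (1 - y) * ∑ l ∈ Finset.range (t + 1), ν l
        ≤ ∑ h ∈ Finset.range (M + 1), (if min (js t) (M - 1) + 1 ≤ h then ν h else 0)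
          + y / (1 - y) * ∑ h ∈ Finset.range (M + 1),
              (if h ≤ min (js t) (M - 1) ∧ τ < (t : ℝ) + h then ν h / usage y τ (min (js t) (M - 1)) t h else 0)) :
    TLC y τ M ν := by
  intro j t hjM htj hlow
  have htM : t < M := lt_of_le_of_lt htj hjM
  have htM' : t ≤ M := htM.le
  -- the hypothesis row at layer `L = min (js t) (M-1)`, functional form
  set L : ℕ := min (js t) (M - 1) with hL
  have hfunL : ∑ a ∈ Finset.range (M + 1), (y / (1 - y) * (if a ≤ t then (1 : ℝ) else 0) - (if L + 1 ≤ a then (1 : ℝ) else 0)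
      - y / (1 - y) * (if a ≤ L ∧ τ < (t : ℝ) + a then 1 / usage y τ L t a else 0)) * ν a ≤ 0 := by
    rw [tlc_functional_sum y τ M t L ν htM']
    have := hrows t hlow htM
    linarith
  -- the row at layer `j`, functional form
  have hfunj : ∑ a ∈ Finset.range (M + 1), (y / (1 - y) * (if a ≤ t then (1 : ℝ) else 0) - (if j + 1 ≤ a then (1 : ℝ) else 0)
      - y / (1 - y) * (if a ≤ j ∧ τ < (t : ℝ) + a then 1 / usage y τ j t a else 0)) * ν a ≤ 0 := by
    rcases Nat.lt_or_ge (js t) M with hjsM | hjsM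
    · -- the natural layer is below the top: `L = js t`
      have hLeq : L = js t := by rw [hL]; exact Nat.min_eq_left (by omega)
      rw [hLeq] at hfunL
      exact tlcRow_functional_of_naturalLayer y τ M t (js t) j ν hy0 hy1 hν hlow (hjs t) (hexp t) (hcheap t) hfunL
    · -- the natural layer is at or above the top: `L = M - 1 ≥ j`, and every atom in `(j, M-1]` is expensive-or-incompatible
      have hLeq : L = M - 1 := by rw [hL]; exact Nat.min_eq_right (by omega)
      rw [hLeq] at hfunL
      refine le_trans (Finset.sum_le_sum fun a ha => mul_le_mul_of_nonneg_right ?_ (hν a)) hfunL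
      refine tlcCoef_le_of_layer_le_expensive y τ t j (M - 1) a hy0 hy1 (by omega) fun _ haM hc => ?_
      have hta : t < a := by
        have : (t : ℝ) < a := by linarith
        exact_mod_cast this
      exact floor_le_usage_of_expensive y τ (M - 1) t a hy0 hy1 hta haM hc (hexp t a hta (by omega) hc)
  rw [tlc_functional_sum y τ M t j ν htM'] at hfunj
  linarith

end LawDec

end Quant

end Summit.CriticalPhenomena.PercolationContinuityZ3.Theorems
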